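import Summits.NavierStokesRegularity.NavierStokesRegularity.Theorems.ScenarioCensusRowD9Core
import HarnessLib

/-!
# Census row D9 TYPED — part 6/9: G1 the modulated dissipation gate, §6d first half — time selection, `∫(T−t)⁻¹ = ∞`,
# `|ℝ³| = ∞`, a.e.-constant `L^p` fields vanish, weak gradient zero ⇒ constant (mollification), test pairings under zoom

Re-homed for the scenario census (typer seat ns-census-typer-1 g7; in scope of the census KEY text «one `def Row_<k> : Prop`
per OPEN row» — row D9 was the one OPEN-NO-LINE row without a typed tree decl, typer-1 g6 HANDOFF 19:50Z; lead programme ended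
at v1.67, base SUMMON-only; ANNOUNCE on the cell STATUS 2026-08-28T20:24Z): VERBATIM PORT of ns-idea-9 LINE 16 «modulation_gate»
rev 5, `pub/ideators/ns-idea-9/lines/modulation_gate/modulation_gate.lean` sha16 1d7b2cd493e504e0 (2259 l., lean check rc 0,
0 sorry; critic idea-crit-8 V66/V67/V69 PASS-WITH-PRICE on rev 1–4, ref ns-census-ref g8 PRE-CHECK ✓ §13.14 [5/6] of rev 4
f704279be2039922; rev 5 = rev 4 + §6e «S0 proved»; TARGET-MENU r4 names this line as row D9's lever; CENSUS-FINAL r6 §2 lists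
`row_F4bp_of_row_D9K` / `row_F4bpLH_of_row_D9LH` as FILES-ONLY edges), split for the 400-line rule into
`ScenarioCensusRowD9Modulation` (§1–§4) → `…RowD9Kernel` (§5) → `…RowD9PowerLaw` (§6) → `…RowD9CoreExponents` (§6c (i)–(iv)) →
`…RowD9Core` (§6c (v)) → `…RowD9DissipationTools` (§6d, first half) → `…RowD9Dissipation` (§6d, second half) →
`…RowD9SteadyLimitTools` (§6e, first half) → `…RowD9` (§6e, second half; §7; census KEYS).  Lean text VERBATIM in namespace
`…Theorems.ScenarioCensus.ModulationGate` (the line's `…Cruxes.Row_F4bp.ModulationGate` re-homed); port edits: the two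
`local notation "E3"` lines → `abbrev E3` (typer lint: no notation in port files), `@[conjecture]` added to the four OPEN
parameterless `def`s `Row_D9K` / `Row_D9LH` / `Row_D9LHWild` / `Row_F4bpLH` (obligation nodes), one-line docstrings added to twelve undocumented auxiliaries, the three
`@[deprecated] stub_*` aliases of §7 not re-declared, four §7 docstrings updated to the rev-5 facts (everything proved).

No census value is asserted here (a summoned lead books row D9; FILES-ONLY edges become TREE by name); NS regularity is NOT
proved; rows D9 / F4b′ stay OPEN (= their wild residuals, by theorem); no summit statement is proved by this file.
-/

-- the summit and its single problem share the name `NavierStokesRegularity` (D-0017 nested layout)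
set_option linter.dupNamespace false

noncomputable section

open Set Function Filter Topology MeasureTheory Metric
open scoped NNReal ENNReal ContDiff

namespace Summit.NavierStokesRegularity.NavierStokesRegularity.Theorems.ScenarioCensus.ModulationGate

open Literature.Analysis Literature.Analysis.FluidPDE
open Summit.NavierStokesRegularity.NavierStokesRegularity.Theorems.ScenarioCensus

/-! ## §6d (rev 4) G1 IS A THEOREM: the modulated dissipation gate, PROVED (sorry-free).  Time selection by
the non-integrability hypothesis `∫_{T−ε}^T λ = ∞` against the LH budget `∫₀ᵀ∫|G|_F² < ∞`, the zoom identity for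
tested pairings at scale `ℓ = λ(t)⁻¹`, Hölder, and «weak gradient zero ⇒ constant ⇒ zero in L^p» by mollification.
The generic lemmas (`exists_good_time` … `eLpNorm_zoom`) are BYTE-VERBATIM LINE 15 rev 4 §4c; only the three
`_mod` / `modulated…` declarations differ (power law ↦ modulation).  No steady equation, no Liouville theorem. -/

namespace DissipationProof

open scoped Convolution
open Literature.Analysis.FunctionSpaces

/-- `ℝ³` (the line's `local notation "E3"`, spelled as a reducible abbreviation for the tree). -/
abbrev E3 := EuclideanSpace ℝ (Fin 3)

/-- **Time selection.** If `P` holds a.e. on `s`, `∫_s F < ∞` and `∫_s g = ∞`, then for every `c ≠ 0`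
some `t ∈ s` has `P t` and `F t < c * g t`. -/
theorem exists_good_time {s : Set ℝ} (hs : MeasurableSet s) {P : ℝ → Prop}
    (hP : ∀ᵐ t ∂(volume.restrict s), P t) {F g : ℝ → ℝ≥0∞} (hF : ∫⁻ t in s, F t ≠ ⊤)
    (hg : ∫⁻ t in s, g t = ⊤) {c : ℝ≥0∞} (hc : c ≠ 0) (hctop : c ≠ ⊤) :
    ∃ t ∈ s, P t ∧ F t < c * g t := by
  by_contra h
  push Not at h
  have hae : ∀ᵐ t ∂(volume.restrict s), c * g t ≤ F t := by
    filter_upwards [hP, ae_restrict_mem hs] with t hPt hts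
    exact h t hts hPt
  have h1 : c * ∫⁻ t in s, g t ≤ ∫⁻ t in s, F t := by
    rw [← lintegral_const_mul' _ _ hctop]
    exact lintegral_mono_ae hae
  rw [hg, ENNReal.mul_top hc] at h1
  exact hF (le_antisymm le_top h1 ▸ rfl)

/-- `∫_{(T−ε, T)} (T − t)⁻¹ dt = ∞` (as a lower integral). -/
theorem lintegral_inv_sub_eq_top (T : ℝ) {ε : ℝ} (hε : 0 < ε) :
    ∫⁻ t in Ioo (T - ε) T, ENNReal.ofReal ((T - t)⁻¹) = ⊤ := by
  by_contra hne
  -- then `t ↦ (T − t)⁻¹` would be integrable on `(T−ε, T)`, hence `t ↦ (t − T)⁻¹` interval-integrable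
  have hmeas : AEStronglyMeasurable (fun t : ℝ => (T - t)⁻¹) (volume.restrict (Ioo (T - ε) T)) :=
    (measurable_const.sub measurable_id).inv.aestronglyMeasurable
  have hfin : HasFiniteIntegral (fun t : ℝ => (T - t)⁻¹) (volume.restrict (Ioo (T - ε) T)) := by
    rw [hasFiniteIntegral_iff_ofReal]
    · exact lt_top_iff_ne_top.2 hne
    · filter_upwards [ae_restrict_mem measurableSet_Ioo] with t ht
      exact inv_nonneg.2 (sub_pos.2 ht.2).le
  have hint : IntegrableOn (fun t : ℝ => (T - t)⁻¹) (Ioo (T - ε) T) := ⟨hmeas, hfin⟩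
  have hint' : IntegrableOn (fun t : ℝ => (t - T)⁻¹) (Ioo (T - ε) T) := by
    have : (fun t : ℝ => (t - T)⁻¹) = fun t => -((T - t)⁻¹) := by
      funext t; rw [← inv_neg, neg_sub]
    rw [this]
    exact hint.neg
  have hii : IntervalIntegrable (fun t : ℝ => (t - T)⁻¹) volume (T - ε) T :=
    (intervalIntegrable_iff_integrableOn_Ioo_of_le (by linarith)).2 hint'
  rw [intervalIntegrable_sub_inv_iff] at hii
  rcases hii with h | h
  · linarith
  · exact h (by rw [Set.uIcc_of_le (by linarith)]; exact ⟨by linarith, le_rfl⟩)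

/-- Lebesgue measure of `ℝ³` is infinite. -/
theorem volume_univ_eq_top : volume (Set.univ : Set E3) = ⊤ := by
  by_contra hne
  have hlt : volume (Set.univ : Set E3) < ⊤ := lt_top_iff_ne_top.2 hne
  have hd : Module.finrank ℝ E3 = 3 := finrank_euclideanSpace_fin
  have hb1 : volume (ball (0 : E3) 1) ≠ 0 := (measure_ball_pos volume (0 : E3) one_pos).ne'
  have hb1t : volume (ball (0 : E3) 1) ≠ ⊤ := measure_ball_lt_top.ne
  -- balls of radius r have measure r³ · |B₁| ≤ |univ| < ∞ for every r: contradiction as r → ∞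
  set M := volume (Set.univ : Set E3) with hM
  have hball : ∀ r : ℝ, 0 < r → ENNReal.ofReal (r ^ 3) * volume (ball (0 : E3) 1) ≤ M := by
    intro r hr
    have h := Measure.addHaar_ball_of_pos volume (0 : E3) hr
    rw [hd] at h
    rw [← h]
    exact measure_mono (subset_univ _)
  -- choose r with r³ · |B₁| > M
  have hMr : M.toReal / (volume (ball (0 : E3) 1)).toReal + 1 ≤
      (M.toReal / (volume (ball (0 : E3) 1)).toReal + 1) ^ 3 := by
    have h1 : 1 ≤ M.toReal / (volume (ball (0 : E3) 1)).toReal + 1 := by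
      have : 0 ≤ M.toReal / (volume (ball (0 : E3) 1)).toReal := by positivity
      linarith
    calc M.toReal / (volume (ball (0 : E3) 1)).toReal + 1
        = (M.toReal / (volume (ball (0 : E3) 1)).toReal + 1) ^ 1 := (pow_one _).symm
      _ ≤ (M.toReal / (volume (ball (0 : E3) 1)).toReal + 1) ^ 3 :=
          pow_le_pow_right₀ h1 (by norm_num)
  set r := M.toReal / (volume (ball (0 : E3) 1)).toReal + 1 with hr
  have hrpos : 0 < r := by
    have : 0 ≤ M.toReal / (volume (ball (0 : E3) 1)).toReal := by positivity
    linarith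
  have h := hball r hrpos
  have h' := ENNReal.toReal_mono hne h
  rw [ENNReal.toReal_mul, ENNReal.toReal_ofReal (by positivity)] at h'
  have hbpos : 0 < (volume (ball (0 : E3) 1)).toReal := ENNReal.toReal_pos hb1 hb1t
  have : r * (volume (ball (0 : E3) 1)).toReal ≤ M.toReal := le_trans (by nlinarith) h'
  have : r ≤ M.toReal / (volume (ball (0 : E3) 1)).toReal := (le_div_iff₀ hbpos).2 this
  linarith

/-- An a.e.-constant `L^p` field on `ℝ³` (`0 < p < ∞`) vanishes a.e. -/
theorem ae_eq_zero_of_ae_eq_const {V : E3 → E3} {c : E3} (hVc : V =ᵐ[volume] fun _ => c)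
    {p : ℝ≥0∞} (hp0 : p ≠ 0) (hptop : p ≠ ⊤) (hV : MemLp V p volume) : V =ᵐ[volume] 0 := by
  have hc : MemLp (fun _ : E3 => c) p volume := hV.ae_eq hVc
  rw [memLp_const_iff hp0 hptop] at hc
  rcases hc with hc | hc
  · rw [hc] at hVc; exact hVc
  · exact absurd hc (by rw [volume_univ_eq_top]; exact lt_irrefl _)

/-- **Weak gradient zero ⇒ a.e. constant** (mollify: `D(φ_ε ⋆ V) = φ_ε ⋆ 0 = 0`, so each mollification
is constant; mollifications converge a.e.). -/
theorem ae_eq_const_of_hasWeakGradient_zero {V : E3 → E3}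
    (hV : HasWeakGradient V (fun _ => (0 : E3 →L[ℝ] E3))) : ∃ c : E3, V =ᵐ[volume] fun _ => c := by
  have hVli : LocallyIntegrable V volume := locallyIntegrableOn_univ.1 (by
    simpa only [TopologicalSpace.Opens.coe_top] using hV.locallyIntegrableOn)
  obtain ⟨φ, hφ0, hφ2⟩ := exists_contDiffBump_seq (E := E3)
  have hae := ae_tendsto_normed_convolution (F := E3) hφ0 hφ2 hVli
  -- each mollification is constant
  have hconst : ∀ n (x : E3), ((φ n).normed volume ⋆[ContinuousLinearMap.lsmul ℝ ℝ, volume] V) x =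
      ((φ n).normed volume ⋆[ContinuousLinearMap.lsmul ℝ ℝ, volume] V) 0 := by
    intro n x
    have hD : ∀ y, HasFDerivAt ((φ n).normed volume ⋆[ContinuousLinearMap.lsmul ℝ ℝ, volume] V)
        (0 : E3 →L[ℝ] E3) y := by
      intro y
      have h := hV.hasFDerivAt_convolution (isTestFunctionOn_normed (φ n)) y
      have hz : ((φ n).normed volume ⋆[ContinuousLinearMap.lsmul ℝ ℝ, volume]
          fun _ : E3 => (0 : E3 →L[ℝ] E3)) = 0 := by
        change ((φ n).normed volume ⋆[ContinuousLinearMap.lsmul ℝ ℝ, volume]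
          (0 : E3 → E3 →L[ℝ] E3)) = 0
        exact convolution_zero
      rwa [hz] at h
    have hdiff : Differentiable ℝ ((φ n).normed volume ⋆[ContinuousLinearMap.lsmul ℝ ℝ, volume] V) :=
      fun y => (hD y).differentiableAt
    exact is_const_of_fderiv_eq_zero hdiff (fun y => (hD y).fderiv) x 0
  -- the constants converge to V x for a.e. x: pick one such x₀
  have hne : (∀ᵐ x ∂(volume : Measure E3), False) → False := by
    intro h
    have : (volume : Measure E3) Set.univ = 0 := by
      simpa using (ae_iff.1 h)
    exact absurd this (by rw [volume_univ_eq_top]; exact ENNReal.top_ne_zero)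
  by_contra hcon
  push Not at hcon
  apply hne
  -- if for every c, V is not a.e. c, derive False a.e.-wise: take x₀ in the good set
  by_contra hgood
  -- there is a point x₀ where the convergence holds
  have hex : ∃ x₀ : E3, Tendsto (fun n => ((φ n).normed volume ⋆[ContinuousLinearMap.lsmul ℝ ℝ, volume] V) x₀)
      atTop (𝓝 (V x₀)) := by
    by_contra hno
    push Not at hno
    apply hgood
    filter_upwards [hae] with x hx
    exact hno x hx
  obtain ⟨x₀, hx₀⟩ := hex
  apply hcon (V x₀)
  filter_upwards [hae] with x hx
  have h1 : Tendsto (fun n => ((φ n).normed volume ⋆[ContinuousLinearMap.lsmul ℝ ℝ, volume] V) 0)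
      atTop (𝓝 (V x)) := by
    have : (fun n => ((φ n).normed volume ⋆[ContinuousLinearMap.lsmul ℝ ℝ, volume] V) x) =
        fun n => ((φ n).normed volume ⋆[ContinuousLinearMap.lsmul ℝ ℝ, volume] V) 0 :=
      funext fun n => hconst n x
    rw [← this]; exact hx
  have h2 : Tendsto (fun n => ((φ n).normed volume ⋆[ContinuousLinearMap.lsmul ℝ ℝ, volume] V) 0)
      atTop (𝓝 (V x₀)) := by
    have : (fun n => ((φ n).normed volume ⋆[ContinuousLinearMap.lsmul ℝ ℝ, volume] V) x₀) =
        fun n => ((φ n).normed volume ⋆[ContinuousLinearMap.lsmul ℝ ℝ, volume] V) 0 :=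
      funext fun n => hconst n x₀
    rw [← this]; exact hx₀
  exact tendsto_nhds_unique h1 h2

/-- **Weak gradient zero + `L^p` (`0 < p < ∞`) ⇒ zero a.e.** -/
theorem ae_eq_zero_of_hasWeakGradient_zero {V : E3 → E3}
    (hV : HasWeakGradient V (fun _ => (0 : E3 →L[ℝ] E3))) {p : ℝ≥0∞} (hp0 : p ≠ 0) (hptop : p ≠ ⊤)
    (hVp : MemLp V p volume) : V =ᵐ[volume] 0 := by
  obtain ⟨c, hc⟩ := ae_eq_const_of_hasWeakGradient_zero hV
  exact ae_eq_zero_of_ae_eq_const hc hp0 hptop hVp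

/-! ### Part B — the analytic estimates -/

/-- A rescaled test function is a test function. -/
theorem isTestFunctionOn_comp_smul {φ : E3 → ℝ} (hφ : IsTestFunctionOn (⊤ : TopologicalSpace.Opens E3) φ)
    {a : ℝ} (ha : a ≠ 0) : IsTestFunctionOn (⊤ : TopologicalSpace.Opens E3) (fun x => φ (a • x)) where
  contDiff := hφ.contDiff.comp (contDiff_id.const_smul a)
  hasCompactSupport := hφ.hasCompactSupport.comp_smul ha
  tsupport_subset := by simp

/-- **(i) Testing against a fixed test function is `L^p`-Lipschitz**: `‖∫ (∂_w φ) • f‖ ≤ C ‖f‖_p`. -/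
theorem test_pairing_le {φ : E3 → ℝ} (hφ : IsTestFunctionOn (⊤ : TopologicalSpace.Opens E3) φ) (w : E3)
    {p : ℝ≥0∞} (hp1 : 1 ≤ p) :
    ∃ C : ℝ≥0∞, C ≠ ⊤ ∧ ∀ f : E3 → E3, AEStronglyMeasurable f volume →
      ‖∫ x, (fderiv ℝ φ x w) • f x‖ₑ ≤ C * eLpNorm f p volume := by
  obtain ⟨C₀, hC₀⟩ := (hφ.contDiff.continuous_fderiv (by simp)).bounded_above_of_compact_support
    (hφ.hasCompactSupport.fderiv ℝ)
  set K := tsupport φ with hK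
  have hKc : IsCompact K := hφ.hasCompactSupport
  have hKfin : volume K ≠ ⊤ := hKc.measure_lt_top.ne
  have hexp : 0 ≤ 1 - 1 / p.toReal := by
    rcases eq_or_ne p ⊤ with hpt | hpt
    · rw [hpt, ENNReal.toReal_top]; norm_num
    · have h1 : 1 ≤ p.toReal := by
        have := (ENNReal.toReal_le_toReal ENNReal.one_ne_top hpt).2 hp1
        simpa using this
      have : 1 / p.toReal ≤ 1 := by
        rw [div_le_one (lt_of_lt_of_le one_pos h1)]; exact h1
      linarith
  refine ⟨ENNReal.ofReal (C₀ * ‖w‖) * volume K ^ (1 - 1 / p.toReal), ?_, fun f hf => ?_⟩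
  · exact ENNReal.mul_ne_top ENNReal.ofReal_ne_top (ENNReal.rpow_ne_top_of_nonneg hexp hKfin)
  · have hsupp : (Function.support fun x => ‖(fderiv ℝ φ x w) • f x‖ₑ) ⊆ K := by
      intro x hx
      by_contra hxK
      apply hx
      have h0 : fderiv ℝ φ x = 0 := by
        have hx' : x ∉ Function.support (fderiv ℝ φ) := fun h => hxK (support_fderiv_subset ℝ h)
        simpa [Function.mem_support] using hx'
      simp [h0]
    have hpt : ∀ x, ‖(fderiv ℝ φ x w) • f x‖ₑ ≤ ENNReal.ofReal (C₀ * ‖w‖) * ‖f x‖ₑ := by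
      intro x
      rw [enorm_smul]
      gcongr
      rw [← ofReal_norm]
      exact ENNReal.ofReal_le_ofReal
        (le_trans (ContinuousLinearMap.le_opNorm _ _) (mul_le_mul_of_nonneg_right (hC₀ x) (norm_nonneg _)))
    calc ‖∫ x, (fderiv ℝ φ x w) • f x‖ₑ
        ≤ ∫⁻ x, ‖(fderiv ℝ φ x w) • f x‖ₑ := enorm_integral_le_lintegral_enorm _
      _ = ∫⁻ x in K, ‖(fderiv ℝ φ x w) • f x‖ₑ := (setLIntegral_eq_of_support_subset hsupp).symm
      _ ≤ ∫⁻ x in K, ENNReal.ofReal (C₀ * ‖w‖) * ‖f x‖ₑ := lintegral_mono fun x => hpt x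
      _ = ENNReal.ofReal (C₀ * ‖w‖) * ∫⁻ x in K, ‖f x‖ₑ :=
          lintegral_const_mul' _ _ ENNReal.ofReal_ne_top
      _ = ENNReal.ofReal (C₀ * ‖w‖) * eLpNorm f 1 (volume.restrict K) := by
          rw [eLpNorm_one_eq_lintegral_enorm]
      _ ≤ ENNReal.ofReal (C₀ * ‖w‖) *
            (eLpNorm f p (volume.restrict K) * (volume.restrict K) Set.univ ^ (1 / (1 : ℝ≥0∞).toReal - 1 / p.toReal)) := by
          gcongr
          exact eLpNorm_le_eLpNorm_mul_rpow_measure_univ hp1 hf.restrict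
      _ ≤ ENNReal.ofReal (C₀ * ‖w‖) * (eLpNorm f p volume * volume K ^ (1 - 1 / p.toReal)) := by
          rw [Measure.restrict_apply_univ, ENNReal.toReal_one, div_one]
          gcongr
          · exact Measure.restrict_le_self
      _ = ENNReal.ofReal (C₀ * ‖w‖) * volume K ^ (1 - 1 / p.toReal) * eLpNorm f p volume := by ring

/-- **(ii) The zoom identity**: testing the zoomed field `y ↦ ℓ u(ℓy)` with `φ` is testing `u` with the
rescaled test function `x ↦ φ(x/ℓ)`, up to the factor `ℓ⁻¹`. -/
theorem zoom_pairing_eq {φ : E3 → ℝ} (hφd : Differentiable ℝ φ) {ℓ : ℝ} (hℓ : 0 < ℓ)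
    (u : E3 → E3) (w : E3) :
    ∫ y, (fderiv ℝ φ y w) • (ℓ • u (ℓ • y)) =
      ℓ⁻¹ • ∫ x, (fderiv ℝ (fun z => φ (ℓ⁻¹ • z)) x w) • u x := by
  have hℓ0 : ℓ ≠ 0 := hℓ.ne'
  have hderiv : ∀ x, fderiv ℝ (fun z => φ (ℓ⁻¹ • z)) x w = ℓ⁻¹ * fderiv ℝ φ (ℓ⁻¹ • x) w := by
    intro x
    have h1 : HasFDerivAt (fun z : E3 => ℓ⁻¹ • z) (ℓ⁻¹ • ContinuousLinearMap.id ℝ E3) x :=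
      (hasFDerivAt_id x).const_smul ℓ⁻¹
    have h2 : HasFDerivAt (fun z => φ (ℓ⁻¹ • z))
        ((fderiv ℝ φ (ℓ⁻¹ • x)).comp (ℓ⁻¹ • ContinuousLinearMap.id ℝ E3)) x :=
      (hφd (ℓ⁻¹ • x)).hasFDerivAt.comp x h1
    rw [h2.fderiv]
    simp [smul_eq_mul]
  have hd : Module.finrank ℝ E3 = 3 := finrank_euclideanSpace_fin
  have key := Measure.integral_comp_inv_smul_of_nonneg volume
    (fun y : E3 => (fderiv ℝ φ y w) • (ℓ • u (ℓ • y))) hℓ.le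
  rw [hd] at key
  have hint : (fun x => (fderiv ℝ (fun z => φ (ℓ⁻¹ • z)) x w) • u x) =
      fun x => (ℓ⁻¹ * ℓ⁻¹) • ((fun y : E3 => (fderiv ℝ φ y w) • (ℓ • u (ℓ • y))) (ℓ⁻¹ • x)) := by
    funext x
    simp only [hderiv]
    rw [smul_smul ℓ ℓ⁻¹ x, mul_inv_cancel₀ hℓ0, one_smul, smul_smul, smul_smul]
    congr 1
    field_simp
  rw [hint, integral_smul, key, smul_smul, smul_smul]
  have : ℓ⁻¹ * (ℓ⁻¹ * ℓ⁻¹) * ℓ ^ 3 = 1 := by field_simp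
  rw [this, one_smul]

/-- `‖L w‖² ≤ |L|_F² ‖w‖²` in `ℝ≥0∞`. -/
theorem enorm_apply_rpow_two_le (L : E3 →L[ℝ] E3) (w : E3) :
    ‖L w‖ₑ ^ (2 : ℝ) ≤ ‖w‖ₑ ^ (2 : ℝ) * ENNReal.ofReal (frobeniusNormSq L) := by
  have h1 : ‖L w‖ ^ 2 ≤ ‖w‖ ^ 2 * frobeniusNormSq L := by
    calc ‖L w‖ ^ 2 ≤ (‖L‖ * ‖w‖) ^ 2 := by
            gcongr; exact L.le_opNorm w
      _ = ‖w‖ ^ 2 * ‖L‖ ^ 2 := by ring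
      _ ≤ ‖w‖ ^ 2 * frobeniusNormSq L := by
            gcongr; exact norm_sq_le_frobeniusNormSq L
  rw [← ofReal_norm, ← ofReal_norm,
    ENNReal.ofReal_rpow_of_nonneg (norm_nonneg _) (by norm_num),
    ENNReal.ofReal_rpow_of_nonneg (norm_nonneg _) (by norm_num), ← ENNReal.ofReal_mul (by positivity),
    Real.rpow_two, Real.rpow_two]
  exact ENNReal.ofReal_le_ofReal h1

/-- `‖G(·) w‖_{L²} ≤ ‖w‖ (∫ |G|_F²)^{1/2}`. -/
theorem eLpNorm_apply_le {G : E3 → E3 →L[ℝ] E3} (w : E3) :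
    eLpNorm (fun x => G x w) 2 volume ≤
      ‖w‖ₑ * (∫⁻ x, ENNReal.ofReal (frobeniusNormSq (G x))) ^ (1 / 2 : ℝ) := by
  rw [eLpNorm_eq_lintegral_rpow_enorm_toReal (by norm_num) ENNReal.ofNat_ne_top, ENNReal.toReal_ofNat]
  have hw : ‖w‖ₑ ^ (2 : ℝ) ≠ ⊤ := ENNReal.rpow_ne_top_of_nonneg (by norm_num) enorm_ne_top
  calc (∫⁻ x, ‖G x w‖ₑ ^ (2 : ℝ)) ^ (1 / (2 : ℝ))
      ≤ (∫⁻ x, ‖w‖ₑ ^ (2 : ℝ) * ENNReal.ofReal (frobeniusNormSq (G x))) ^ (1 / (2 : ℝ)) := by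
        gcongr with x
        exact enorm_apply_rpow_two_le (G x) w
    _ = (‖w‖ₑ ^ (2 : ℝ) * ∫⁻ x, ENNReal.ofReal (frobeniusNormSq (G x))) ^ (1 / (2 : ℝ)) := by
        rw [lintegral_const_mul' _ _ hw]
    _ = ‖w‖ₑ * (∫⁻ x, ENNReal.ofReal (frobeniusNormSq (G x))) ^ (1 / 2 : ℝ) := by
        rw [ENNReal.mul_rpow_of_nonneg _ _ (by norm_num), ← ENNReal.rpow_mul]
        norm_num

end DissipationProof

end Summit.NavierStokesRegularity.NavierStokesRegularity.Theorems.ScenarioCensus.ModulationGate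

end
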